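import Summits.FinalStateConjecture.FinalStateConjecture.Theorems.ClusterCompletenessAdiabaticMultiKerrILEDLateRedShiftLab
import Summits.FinalStateConjecture.FinalStateConjecture.Theorems.ClusterCompletenessAdiabaticMultiKerrILEDLateIneq
import Summits.FinalStateConjecture.FinalStateConjecture.Theorems.ClusterCompletenessAdiabaticMultiKerrILEDLateSplit
import Summits.FinalStateConjecture.FinalStateConjecture.Theorems.ClusterCompletenessAdiabaticMultiKerrILEDFiniteTimeEnergy
import HarnessLib

/-!
# Route ClusterCompleteness — crux `AdiabaticMultiKerrILED`, line `Sketch`: the assembly of the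
# late-time energy bound (a) from the red-shift estimate and the far-energy bound

Closes the lead's stub `stub_lateAssembly` of line `Sketch` of the crux `stmt-FinalStateConjecture-14310`
(`Summit.FinalStateConjecture.FinalStateConjecture.Theses.ClusterCompleteness.AdiabaticMultiKerrILED`):
the late-time lab-energy bound `E[ψ](t) ≤ C E[ψ](0)`, `t ≥ t₁`, for every `N ≥ 1`, follows from

* `hRS` — the red-shift estimate between graph leaves near a sub-extremal Kerr horizon with LOCAL
  hypotheses (`stub_redShiftLocal`; Dafermos–Rodnianski–Shlapentokh-Rothman arXiv:1402.7034,
  Prop. 4.5.2; Dafermos–Rodnianski arXiv:0811.0354, §3.3.3);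
* `hPB` — the rest-frame pull-back of a crux solution solves the exact Kerr equation in each zone
  (`stub_zonePullbackWave`);
* `hSL` — lab slices are affine images of linear rest-frame leaves, with the change-of-variables
  identities (`stub_sliceLeafCorrespondence`);
* `hBI` — boundedness from the lossy integral inequality (`stub_boundedOfIntegralIneq`);
* `hFB` — the research stub `stub_farEnergyBound_pos`: the lab energy away from all horizons is
  bounded by `C E[ψ](0)` from a time `t₁` on;

by Dafermos–Rodnianski's red-shift boundedness argument (arXiv:0811.0354, §3.3.4) run on the lab
foliation (helpers `collar_redshift_lab`, `late_integral_inequality`, `late_energy_split`,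
`late_final_bound`) and the classical finite-time growth bound `stub_finiteTimeEnergy`. [folklore]
-/

noncomputable section

-- the doubled `FinalStateConjecture.FinalStateConjecture` path component trips dupNamespace
set_option linter.dupNamespace false

open scoped ContDiff Topology BigOperators ENNReal InnerProductSpace
open Filter Set MeasureTheory Literature.Geometry.Lorentzian

namespace Summit.FinalStateConjecture.FinalStateConjecture.Cruxes.AdiabaticMultiKerrILED.Sketch

/-- **Sub-extremality from the spin threshold**: `|a| ≤ M/2` and `M > 0` give `|a| < M`
(`Kerr.IsSubextremal`), so every hole of the configuration has a non-degenerate horizon and the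
red-shift estimate applies (Dafermos–Rodnianski arXiv:0811.0354, §3.3). [folklore] -/
theorem isSubextremal_of_abs_le_half_mul {M a : ℝ} (hM : 0 < M) (ha : |a| ≤ 2⁻¹ * M) :
    Kerr.IsSubextremal M a := by
  show |a| < M
  linarith

/-- **Assembly of the late-time bound (a) for `N ≥ 1`** (the lead's stub of line `Sketch`):
Dafermos–Rodnianski's red-shift boundedness argument (arXiv:0811.0354, §3.3.4) run on the lab
foliation. Split `E[ψ](t)` into the far part `{∀ i, rᵢ ≥ r₊ᵢ + (η/2)Mᵢ}` — bounded by `C E[ψ](0)`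
from `t₁` on (`hFB`) — and the half-collars `{r₊ᵢ < rᵢ ≤ r₊ᵢ + ηMᵢ/2}`; on each collar the local
red-shift estimate between lab slices (`hRS` for the pull-back `Φᵢ = ψ ∘ Pᵢ`, a Kerr solution in
zone `i` by `hPB`, transported to lab variables by `hSL`: `collar_redshift_lab`) bounds the collar
quantity at `s₂` plus `(1/uᵢ⁰)×` its time integral by the full collar at `s₁` plus the time integral
of the shell quantity, and the shell lies in the far set; summing over `i` gives the lossy integral
inequality of `hBI` (`late_integral_inequality`) for `G = Σᵢ (half-collar quantities)` from
`max(t₁, 0)` on, whence `G` is bounded; finally `E ≤ far + κ G`, `G(tₐ) ≤ κ E(tₐ)` (`late_energy_split`)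
and the finite-time growth bound `stub_finiteTimeEnergy` at `tₐ = max(t₁, 0)` close the estimate
(`late_final_bound`). The uniform collar parameter `η` (`η Mᵢ ≤ η₀(Mᵢ, aᵢ)`, `η ≤ 1`) comes from
`exists_pos_le_one_forall_mul_le`. [folklore] -/
theorem stub_lateAssembly
    (hRS : ∀ (M a : ℝ), Kerr.IsSubextremal M a →
      ∃ η₀ : ℝ, 0 < η₀ ∧ ∀ η : ℝ, 0 < η → η ≤ η₀ → ∃ C : ℝ, 0 < C ∧
        ∀ (F : E3 → ℝ) (c : ℝ), ContDiff ℝ 2 F → 0 < c → c ≤ 1 →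
        (∀ y, ‖fderiv ℝ F y‖ ≤ 1 - c) →
        ∀ Φ : E4 → ℝ,
        (∀ x ∈ (Kerr.exterior M a : Set E4), ContDiffAt ℝ 2 Φ x) →
        (∀ x ∈ (Kerr.exterior M a : Set E4), Kerr.radius a x ≤ Kerr.rPlus M a + η →
          F (E4.spatial x) ≤ x 0 →
          KerrSchild.waveOperator
            (KerrSchild.inverseMetric (fun y ↦ 2 * Kerr.scalarH M a y) (Kerr.nullVector a)) Φ x = 0) →
        ∀ s : ℝ, 0 ≤ s →
          (∫⁻ y, {y : E3 | Kerr.rPlus M a < Kerr.radius a (E4.ofTimeSpace (s + F y) y) ∧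
                Kerr.radius a (E4.ofTimeSpace (s + F y) y) ≤ Kerr.rPlus M a + η / 2}.indicator
              (fun y ↦ ENNReal.ofReal
                (∑ μ, fderiv ℝ Φ (E4.ofTimeSpace (s + F y) y) (E4.basisVector μ) ^ 2)) y) +
            ∫⁻ u in Set.Ioc 0 s, ∫⁻ y,
              {y : E3 | Kerr.rPlus M a < Kerr.radius a (E4.ofTimeSpace (u + F y) y) ∧
                Kerr.radius a (E4.ofTimeSpace (u + F y) y) ≤ Kerr.rPlus M a + η / 2}.indicator
              (fun y ↦ ENNReal.ofReal
                (∑ μ, fderiv ℝ Φ (E4.ofTimeSpace (u + F y) y) (E4.basisVector μ) ^ 2)) y ≤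
          ENNReal.ofReal (C / c) *
            ((∫⁻ y, {y : E3 | Kerr.rPlus M a < Kerr.radius a (E4.ofTimeSpace (0 + F y) y) ∧
                  Kerr.radius a (E4.ofTimeSpace (0 + F y) y) ≤ Kerr.rPlus M a + η}.indicator
                (fun y ↦ ENNReal.ofReal
                  (∑ μ, fderiv ℝ Φ (E4.ofTimeSpace (0 + F y) y) (E4.basisVector μ) ^ 2)) y) +
              ∫⁻ u in Set.Ioc 0 s, ∫⁻ y,
                {y : E3 | Kerr.rPlus M a + η / 2 ≤ Kerr.radius a (E4.ofTimeSpace (u + F y) y) ∧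
                  Kerr.radius a (E4.ofTimeSpace (u + F y) y) ≤ Kerr.rPlus M a + η}.indicator
                (fun y ↦ ENNReal.ofReal
                  (∑ μ, fderiv ℝ Φ (E4.ofTimeSpace (u + F y) y) (E4.basisVector μ) ^ 2)) y))
    (hPB : ∀ {N : ℕ} (M a : Fin N → ℝ) (Λ : Fin N → lorentzGroup) (p : Fin N → E3) (u : Fin N → E4)
        (q : Fin N → E4 → E4),
        (∀ i, u i = (Λ i : E4 ≃L[ℝ] E4) (E4.basisVector 0)) →
        (∀ i x, q i x = poincareInv (Λ i) (E4.ofTimeSpace 0 (p i)) x) →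
        (∀ i, 0 < M i) → (∀ i, |a i| ≤ 2⁻¹ * M i) →
        (∀ i, 0 < u i 0 ∧ ‖E4.spatial (u i)‖ ≤ 2⁻¹ * u i 0) →
        (∀ i j, i ≠ j → 40 * (M i + M j) ≤ dist (p i) (p j) ∧
          0 < ⟪p i - p j, (u i 0)⁻¹ • E4.spatial (u i) - (u j 0)⁻¹ • E4.spatial (u j)⟫_ℝ) →
        ∀ (G : E4 → Fin 4 → Fin 4 → ℝ),
        (∀ x μ ν, G x μ ν = Minkowski.bilin (E4.basisVector μ) (E4.basisVector ν) -
          ∑ i, Real.smoothTransition (2 - Kerr.radius (a i) (q i x) / (8 * M i)) *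
            (2 * Kerr.scalarH (M i) (a i) (q i x)) *
            ((Λ i : E4 ≃L[ℝ] E4) (Kerr.nullVector (a i) (q i x))) μ *
            ((Λ i : E4 ≃L[ℝ] E4) (Kerr.nullVector (a i) (q i x))) ν) →
        ∀ ψ : E4 → ℝ, ContDiff ℝ ∞ ψ →
          (∀ x : E4, 0 ≤ x 0 → (∀ i, Kerr.rPlus (M i) (a i) < Kerr.radius (a i) (q i x)) →
            ∑ μ : Fin 4, fderiv ℝ (fun y ↦ ∑ ν : Fin 4, G y μ ν * fderiv ℝ ψ y (E4.basisVector ν)) x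
              (E4.basisVector μ) = 0) →
          ∀ (i : Fin N) (z : E4),
            0 ≤ ((Λ i : E4 ≃L[ℝ] E4) z + E4.ofTimeSpace 0 (p i)) 0 →
            Kerr.rPlus (M i) (a i) < Kerr.radius (a i) z → Kerr.radius (a i) z < 8 * M i →
            KerrSchild.waveOperator
              (KerrSchild.inverseMetric (fun y ↦ 2 * Kerr.scalarH (M i) (a i) y) (Kerr.nullVector (a i)))
              (fun w ↦ ψ ((Λ i : E4 ≃L[ℝ] E4) w + E4.ofTimeSpace 0 (p i))) z = 0)
    (hSL : ∀ (Λ : lorentzGroup) (p : E3) (u : E4) (q : E4 → E4),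
        u = (Λ : E4 ≃L[ℝ] E4) (E4.basisVector 0) → (∀ x, q x = poincareInv Λ (E4.ofTimeSpace 0 p) x) →
        0 < u 0 → ‖E4.spatial u‖ ≤ 2⁻¹ * u 0 →
        ∃ (F : E3 → ℝ) (J κ : ℝ), 0 < J ∧ 0 < κ ∧ ContDiff ℝ ∞ F ∧ (∀ y, ‖fderiv ℝ F y‖ ≤ 2⁻¹) ∧
          (∀ x : E4, q x 0 = (u 0)⁻¹ * x 0 + F (E4.spatial (q x))) ∧
          (∀ (g : E4 → ℝ≥0∞) (t : ℝ), ∫⁻ y : E3, g (q (E4.ofTimeSpace t y)) =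
            ENNReal.ofReal J * ∫⁻ y' : E3, g (E4.ofTimeSpace ((u 0)⁻¹ * t + F y') y')) ∧
          (∀ (f : ℝ → ℝ≥0∞) (t₁ t₂ : ℝ), t₁ ≤ t₂ →
            ∫⁻ t in Set.Ioc t₁ t₂, f ((u 0)⁻¹ * (t - t₁)) =
              ENNReal.ofReal (u 0) * ∫⁻ s in Set.Ioc 0 ((u 0)⁻¹ * (t₂ - t₁)), f s) ∧
          (∀ (ψ : E4 → ℝ) (x : E4), DifferentiableAt ℝ ψ x →
            ∑ μ, (fderiv ℝ (fun w ↦ ψ ((Λ : E4 ≃L[ℝ] E4) w + E4.ofTimeSpace 0 p)) (q x)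
                (E4.basisVector μ)) ^ 2 ≤ κ * ∑ μ, (fderiv ℝ ψ x (E4.basisVector μ)) ^ 2 ∧
            ∑ μ, (fderiv ℝ ψ x (E4.basisVector μ)) ^ 2 ≤
              κ * ∑ μ, (fderiv ℝ (fun w ↦ ψ ((Λ : E4 ≃L[ℝ] E4) w + E4.ofTimeSpace 0 p)) (q x)
                (E4.basisVector μ)) ^ 2))
    (hBI : ∀ (G : ℝ → ℝ≥0∞) (t₀ : ℝ) (B : NNReal) (K : ℝ≥0∞), Measurable G → 1 ≤ B →
        (∀ s, t₀ ≤ s → G s ≠ ⊤) →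
        (∀ s₁ s₂ : ℝ, t₀ ≤ s₁ → s₁ ≤ s₂ →
          G s₂ + ∫⁻ s in Set.Ioc s₁ s₂, G s ≤
            (B : ℝ≥0∞) * G s₁ + K * ENNReal.ofReal (1 + (s₂ - s₁))) →
        ∀ t, t₀ ≤ t → G t ≤ 10 * ((B : ℝ≥0∞) + 1) * (G t₀ + K))
    (hFB : ∀ N : ℕ, 0 < N → ∃ d₀ α v₀ : ℝ, 0 < d₀ ∧ 0 < α ∧ 0 < v₀ ∧
      ∀ (M a : Fin N → ℝ) (Λ : Fin N → lorentzGroup) (p : Fin N → E3) (u : Fin N → E4)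
        (q : Fin N → E4 → E4),
        (∀ i, u i = (Λ i : E4 ≃L[ℝ] E4) (E4.basisVector 0)) →
        (∀ i x, q i x = poincareInv (Λ i) (E4.ofTimeSpace 0 (p i)) x) →
        (∀ i, 0 < M i) → (∀ i, |a i| ≤ α * M i) →
        (∀ i, 0 < u i 0 ∧ ‖E4.spatial (u i)‖ ≤ v₀ * u i 0) →
        (∀ i j, i ≠ j → d₀ * (M i + M j) ≤ dist (p i) (p j) ∧
          0 < ⟪p i - p j, (u i 0)⁻¹ • E4.spatial (u i) - (u j 0)⁻¹ • E4.spatial (u j)⟫_ℝ) →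
        ∀ (G : E4 → Fin 4 → Fin 4 → ℝ),
        (∀ x μ ν, G x μ ν = Minkowski.bilin (E4.basisVector μ) (E4.basisVector ν) -
          ∑ i, Real.smoothTransition (2 - Kerr.radius (a i) (q i x) / (8 * M i)) *
            (2 * Kerr.scalarH (M i) (a i) (q i x)) *
            ((Λ i : E4 ≃L[ℝ] E4) (Kerr.nullVector (a i) (q i x))) μ *
            ((Λ i : E4 ≃L[ℝ] E4) (Kerr.nullVector (a i) (q i x))) ν) →
        ∀ (E : (E4 → ℝ) → ℝ → ENNReal),
        (∀ φ t, E φ t = ∫⁻ y in {y : E3 | ∀ i, Kerr.rPlus (M i) (a i) <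
            Kerr.radius (a i) (q i (E4.ofTimeSpace t y))},
          ENNReal.ofReal (∑ μ : Fin 4, (fderiv ℝ φ (E4.ofTimeSpace t y) (E4.basisVector μ)) ^ 2)) →
        ∀ η : ℝ, 0 < η → ∃ (t₁ : ℝ) (C : NNReal), ∀ ψ : E4 → ℝ, ContDiff ℝ ∞ ψ →
          (∀ x : E4, 0 ≤ x 0 → (∀ i, Kerr.rPlus (M i) (a i) < Kerr.radius (a i) (q i x)) →
            ∑ μ : Fin 4, fderiv ℝ (fun y ↦ ∑ ν : Fin 4, G y μ ν * fderiv ℝ ψ y (E4.basisVector ν)) x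
              (E4.basisVector μ) = 0) →
          ∀ t : ℝ, t₁ ≤ t →
            ∫⁻ y in {y : E3 | ∀ i, Kerr.rPlus (M i) (a i) + η * M i ≤
                Kerr.radius (a i) (q i (E4.ofTimeSpace t y))},
              ENNReal.ofReal (∑ μ : Fin 4, (fderiv ℝ ψ (E4.ofTimeSpace t y) (E4.basisVector μ)) ^ 2) ≤
            (C : ENNReal) * E ψ 0) :
    ∀ N : ℕ, 0 < N → ∃ d₀ α v₀ : ℝ, 0 < d₀ ∧ 0 < α ∧ 0 < v₀ ∧
    ∀ (M a : Fin N → ℝ) (Λ : Fin N → lorentzGroup) (p : Fin N → E3) (u : Fin N → E4)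
      (q : Fin N → E4 → E4),
      (∀ i, u i = (Λ i : E4 ≃L[ℝ] E4) (E4.basisVector 0)) →
      (∀ i x, q i x = poincareInv (Λ i) (E4.ofTimeSpace 0 (p i)) x) →
      (∀ i, 0 < M i) → (∀ i, |a i| ≤ α * M i) →
      (∀ i, 0 < u i 0 ∧ ‖E4.spatial (u i)‖ ≤ v₀ * u i 0) →
      (∀ i j, i ≠ j → d₀ * (M i + M j) ≤ dist (p i) (p j) ∧
        0 < ⟪p i - p j, (u i 0)⁻¹ • E4.spatial (u i) - (u j 0)⁻¹ • E4.spatial (u j)⟫_ℝ) →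
      ∀ (G : E4 → Fin 4 → Fin 4 → ℝ),
      (∀ x μ ν, G x μ ν = Minkowski.bilin (E4.basisVector μ) (E4.basisVector ν) -
        ∑ i, Real.smoothTransition (2 - Kerr.radius (a i) (q i x) / (8 * M i)) *
          (2 * Kerr.scalarH (M i) (a i) (q i x)) *
          ((Λ i : E4 ≃L[ℝ] E4) (Kerr.nullVector (a i) (q i x))) μ *
          ((Λ i : E4 ≃L[ℝ] E4) (Kerr.nullVector (a i) (q i x))) ν) →
      ∀ (E : (E4 → ℝ) → ℝ → ENNReal),
      (∀ φ t, E φ t = ∫⁻ y in {y : E3 | ∀ i, Kerr.rPlus (M i) (a i) <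
          Kerr.radius (a i) (q i (E4.ofTimeSpace t y))},
        ENNReal.ofReal (∑ μ : Fin 4, (fderiv ℝ φ (E4.ofTimeSpace t y) (E4.basisVector μ)) ^ 2)) →
      ∃ (t₁ : ℝ) (C : NNReal), ∀ ψ : E4 → ℝ, ContDiff ℝ ∞ ψ →
        (∀ x : E4, 0 ≤ x 0 → (∀ i, Kerr.rPlus (M i) (a i) < Kerr.radius (a i) (q i x)) →
          ∑ μ : Fin 4, fderiv ℝ (fun y ↦ ∑ ν : Fin 4, G y μ ν * fderiv ℝ ψ y (E4.basisVector ν)) x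
            (E4.basisVector μ) = 0) →
        ∀ t : ℝ, t₁ ≤ t → E ψ t ≤ (C : ENNReal) * E ψ 0 := by
  intro N hN
  obtain ⟨d₀, α, v₀, hd₀, hα, hv₀, HFB⟩ := hFB N hN
  refine ⟨max d₀ 40, min α 2⁻¹, min v₀ 2⁻¹, lt_max_of_lt_left hd₀, lt_min hα (by norm_num),
    lt_min hv₀ (by norm_num), ?_⟩
  intro M a Λ p u q hu hq hM ha hv hsep G hG E hE
  -- ### the two threshold regimes
  have ha₁ : ∀ i, |a i| ≤ α * M i := fun i ↦
    (ha i).trans (mul_le_mul_of_nonneg_right (min_le_left _ _) (hM i).le)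
  have ha₂ : ∀ i, |a i| ≤ 2⁻¹ * M i := fun i ↦
    (ha i).trans (mul_le_mul_of_nonneg_right (min_le_right _ _) (hM i).le)
  have hv₁ : ∀ i, 0 < u i 0 ∧ ‖E4.spatial (u i)‖ ≤ v₀ * u i 0 := fun i ↦
    ⟨(hv i).1, (hv i).2.trans (mul_le_mul_of_nonneg_right (min_le_left _ _) (hv i).1.le)⟩
  have hv₂ : ∀ i, 0 < u i 0 ∧ ‖E4.spatial (u i)‖ ≤ 2⁻¹ * u i 0 := fun i ↦
    ⟨(hv i).1, (hv i).2.trans (mul_le_mul_of_nonneg_right (min_le_right _ _) (hv i).1.le)⟩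
  have hsep₁ : ∀ i j, i ≠ j → d₀ * (M i + M j) ≤ dist (p i) (p j) ∧
      0 < ⟪p i - p j, (u i 0)⁻¹ • E4.spatial (u i) - (u j 0)⁻¹ • E4.spatial (u j)⟫_ℝ :=
    fun i j hij ↦ ⟨(mul_le_mul_of_nonneg_right (le_max_left _ _) (add_pos (hM i) (hM j)).le).trans
      (hsep i j hij).1, (hsep i j hij).2⟩
  have hsep₂ : ∀ i j, i ≠ j → 40 * (M i + M j) ≤ dist (p i) (p j) ∧
      0 < ⟪p i - p j, (u i 0)⁻¹ • E4.spatial (u i) - (u j 0)⁻¹ • E4.spatial (u j)⟫_ℝ :=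
    fun i j hij ↦ ⟨(mul_le_mul_of_nonneg_right (le_max_right _ _) (add_pos (hM i) (hM j)).le).trans
      (hsep i j hij).1, (hsep i j hij).2⟩
  -- ### red-shift constants, uniform collar parameter, slice/leaf data, far and finite-time bounds
  have hMa : ∀ i, Kerr.IsSubextremal (M i) (a i) := fun i ↦
    isSubextremal_of_abs_le_half_mul (hM i) (ha₂ i)
  choose η₀ hη₀ Hrs₁ using fun i ↦ hRS (M i) (a i) (hMa i)
  obtain ⟨η, hη0, hη1, hηM⟩ := exists_pos_le_one_forall_mul_le M η₀ hM hη₀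
  choose Crs hCrs HRS using fun i ↦ Hrs₁ i (η * M i) (mul_pos hη0 (hM i)) (hηM i)
  choose F J κ hJ hκ hF hFslope hSL1 hSL2 hSL3 hSL4 using
    fun i ↦ hSL (Λ i) (p i) (u i) (q i) (hu i) (hq i) (hv i).1 (hv₂ i).2
  obtain ⟨t₁, Cfb, HFB'⟩ := HFB M a Λ p u q hu hq hM ha₁ hv₁ hsep₁ G hG E hE (η / 2) (by positivity)
  obtain ⟨Kft, hKft0, HFT⟩ := stub_finiteTimeEnergy N M a Λ p u q hu hq hM ha₂ hv₂ hsep₂ G hG E hE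
  -- ### constants
  have hu1 : ∀ i, 1 ≤ u i 0 := fun i ↦ by
    have h := Theorems.one_le_abs_lorentz_apply_zero (Λ i)
    rw [← hu i, abs_of_pos (hv i).1] at h
    exact h
  set U : ℝ := ∑ i, u i 0 with hUdef
  have hU : ∀ i, u i 0 ≤ U := fun i ↦
    Finset.single_le_sum (fun j _ ↦ (hv j).1.le) (Finset.mem_univ i)
  have hU0 : 1 ≤ U := (hu1 ⟨0, hN⟩).trans (hU ⟨0, hN⟩)
  set Cs : ℝ := ∑ i, Crs i with hCsdef
  have hCs : ∀ i, Crs i ≤ Cs := fun i ↦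
    Finset.single_le_sum (fun j _ ↦ (hCrs j).le) (Finset.mem_univ i)
  have hCs0 : 0 ≤ Cs := Finset.sum_nonneg fun j _ ↦ (hCrs j).le
  set κs : ℝ := ∑ i, κ i with hκsdef
  have hκs : ∀ i, κ i ≤ κs := fun i ↦
    Finset.single_le_sum (fun j _ ↦ (hκ j).le) (Finset.mem_univ i)
  have hκs0 : 0 ≤ κs := Finset.sum_nonneg fun j _ ↦ (hκ j).le
  set ta : ℝ := max t₁ 0 with hta
  have hta0 : 0 ≤ ta := le_max_right _ _
  have hta1 : t₁ ≤ ta := le_max_left _ _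
  set Bc : ℝ := 2 * Cs * U with hBc
  have hBc0 : 0 ≤ Bc := by positivity
  set L : ℝ := Kft * Real.exp (Kft * ta) with hL
  have hL0 : 0 ≤ L := by positivity
  set k : ℝ := 2 * Cs * U * (N * κs) * Cfb with hk
  have hk0 : 0 ≤ k := by positivity
  set Cfin : ℝ := (Cfb : ℝ) + κs * (10 * ((Bc + 1) + 1)) * (κs * L + k) + 1 with hCfin
  have hCfin0 : 0 < Cfin := by positivity
  refine ⟨ta, Real.toNNReal Cfin, fun ψ hψ hsol t ht ↦ ?_⟩
  -- ### one solution
  have ht0 : 0 ≤ t := hta0.trans ht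
  have htt₁ : t₁ ≤ t := hta1.trans ht
  by_cases htop : E ψ 0 = ⊤
  · have hC0 : (Real.toNNReal Cfin : ℝ≥0∞) ≠ 0 := by
      exact_mod_cast (Real.toNNReal_pos.mpr hCfin0).ne'
    rw [htop, ENNReal.mul_top hC0]
    exact le_top
  have hψ1 : ContDiff ℝ 1 ψ := by have := contDiff_infty.1 hψ 1; exact_mod_cast this
  set Φ : Fin N → E4 → ℝ := fun i w ↦ ψ ((Λ i : E4 ≃L[ℝ] E4) w + E4.ofTimeSpace 0 (p i)) with hΦ
  have hΦs : ∀ i, ContDiff ℝ ∞ (Φ i) := fun i ↦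
    hψ.comp ((((Λ i : E4 ≃L[ℝ] E4) : E4 →L[ℝ] E4).contDiff).add contDiff_const)
  have hΦ1 : ∀ i, ContDiff ℝ 1 (Φ i) := fun i ↦ by
    have := contDiff_infty.1 (hΦs i) 1; exact_mod_cast this
  have hΦ2 : ∀ i, ContDiff ℝ 2 (Φ i) := fun i ↦ by
    have := contDiff_infty.1 (hΦs i) 2; exact_mod_cast this
  have HPBψ : ∀ (i : Fin N) (z : E4), 0 ≤ ((Λ i : E4 ≃L[ℝ] E4) z + E4.ofTimeSpace 0 (p i)) 0 →
      Kerr.rPlus (M i) (a i) < Kerr.radius (a i) z → Kerr.radius (a i) z < 8 * M i →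
      KerrSchild.waveOperator (KerrSchild.inverseMetric (fun y ↦ 2 * Kerr.scalarH (M i) (a i) y)
        (Kerr.nullVector (a i))) (Φ i) z = 0 :=
    fun i ↦ hPB M a Λ p u q hu hq hM ha₂ hv₂ hsep₂ G hG ψ hψ hsol i
  have hcmp : ∀ i x, ENNReal.ofReal (∑ μ, fderiv ℝ (Φ i) (q i x) (E4.basisVector μ) ^ 2) ≤
      ENNReal.ofReal (κ i) *
        ENNReal.ofReal (∑ μ : Fin 4, (fderiv ℝ ψ x (E4.basisVector μ)) ^ 2) := fun i x ↦ by
    have h := (hSL4 i ψ x (hψ.differentiable (by simp)).differentiableAt).1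
    rw [← ENNReal.ofReal_mul (hκ i).le]
    exact ENNReal.ofReal_le_ofReal h
  have hcmp' : ∀ i x, ENNReal.ofReal (∑ μ : Fin 4, (fderiv ℝ ψ x (E4.basisVector μ)) ^ 2) ≤
      ENNReal.ofReal (κ i) *
        ENNReal.ofReal (∑ μ, fderiv ℝ (Φ i) (q i x) (E4.basisVector μ) ^ 2) := fun i x ↦ by
    have h := (hSL4 i ψ x (hψ.differentiable (by simp)).differentiableAt).2
    rw [← ENNReal.ofReal_mul (hκ i).le]
    exact ENNReal.ofReal_le_ofReal h
  -- ### the lossy integral inequality for the total half-collar quantity `G`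
  set W : ℝ≥0∞ := (Cfb : ℝ≥0∞) * E ψ 0 with hW
  have hineq := late_integral_inequality hu hq hM ha₂ hv₂ hsep₂ hη1 (κ := κ) (C := Crs) hU hu1 hU0
    hCs hCs0 hκs hψ1 hΦ1 hcmp (t₁ := t₁) (W := W)
    (fun τ hτ _ ↦ HFB' ψ hψ hsol τ hτ)
    (fun i s₁ s₂ h0 h ↦ collar_redshift_lab (hq i) (hv i).1 (hF i) (hFslope i) (hSL1 i) (hSL2 i)
      (hSL3 i) (hM i) (mul_le_of_le_one_left (hM i).le hη1) (HRS i) (hΦ2 i) (HPBψ i) h0 h)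
  set Gf : ℝ → ℝ≥0∞ := fun τ ↦ ∑ i, ∫⁻ y : E3,
    {z : E4 | Kerr.rPlus (M i) (a i) < Kerr.radius (a i) z ∧
        Kerr.radius (a i) z ≤ Kerr.rPlus (M i) (a i) + η * M i / 2}.indicator
      (fun z ↦ ENNReal.ofReal (∑ μ, fderiv ℝ (Φ i) z (E4.basisVector μ) ^ 2))
      (q i (E4.ofTimeSpace τ y)) with hGf
  set B : NNReal := Real.toNNReal Bc + 1 with hB
  have hBco : (B : ℝ≥0∞) = ENNReal.ofReal (Bc + 1) := by
    rw [hB, ENNReal.coe_add, ENNReal.coe_one, ENNReal.ofReal_add hBc0 zero_le_one,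
      ENNReal.ofReal_one]
    rfl
  set Kc : ℝ≥0∞ := ENNReal.ofReal (2 * Cs * U * (N * κs)) * W with hKc
  have hGineq : ∀ s₁ s₂ : ℝ, ta ≤ s₁ → s₁ ≤ s₂ →
      Gf s₂ + ∫⁻ s in Set.Ioc s₁ s₂, Gf s ≤
        (B : ℝ≥0∞) * Gf s₁ + Kc * ENNReal.ofReal (1 + (s₂ - s₁)) := by
    intro s₁ s₂ hs₁ hs
    refine (hineq s₁ s₂ hs₁ hs).trans ?_
    rw [hBco, ENNReal.ofReal_add hBc0 zero_le_one, ENNReal.ofReal_one, hKc]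
    gcongr
    exact le_self_add
  -- ### measurability and finiteness of `G`, then the real-variable lemma `hBI`
  have hqc : ∀ i, Continuous (q i) := fun i ↦ by
    rw [show q i = poincareInv (Λ i) (E4.ofTimeSpace 0 (p i)) from funext (hq i)]
    exact continuous_poincareInv _ _
  have hGm : Measurable Gf := by
    refine Finset.measurable_sum _ fun i _ ↦ ?_
    exact measurable_lintegral_comp_slice
      ((measurable_energyDensity (hΦ1 i)).indicator (measurableSet_radius_collar _ _ _).1) (hqc i)
  have hsplit := fun (τ : ℝ) (hτ : 0 ≤ τ) ↦ late_energy_split hu hq hM ha₂ hv₂ hsep₂ hη1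
    (fun i ↦ (hκ i).le) hκs le_rfl hψ1 (Φ := Φ) hcmp hcmp' hτ
  have hGE : ∀ τ, 0 ≤ τ → Gf τ ≤ ENNReal.ofReal κs * E ψ τ := fun τ hτ ↦ by
    rw [hE ψ τ]; exact (hsplit τ hτ).2
  have hGfin : ∀ s, ta ≤ s → Gf s ≠ ⊤ := by
    intro s hs
    have hs0 : 0 ≤ s := hta0.trans hs
    refine (lt_of_le_of_lt ((hGE s hs0).trans (mul_le_mul' le_rfl (HFT ψ hψ hsol s hs0))) ?_).ne
    exact ENNReal.mul_lt_top ENNReal.ofReal_lt_top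
      (ENNReal.mul_lt_top ENNReal.ofReal_lt_top (lt_top_iff_ne_top.2 htop))
  have hB1 : 1 ≤ B := by rw [hB]; exact le_add_self
  have hbound := hBI Gf ta B Kc hGm hB1 hGfin hGineq t ht
  -- ### close
  have h1 : E ψ t ≤ (∫⁻ y in {y : E3 | ∀ i, Kerr.rPlus (M i) (a i) + η / 2 * M i ≤
      Kerr.radius (a i) (q i (E4.ofTimeSpace t y))},
        ENNReal.ofReal (∑ μ : Fin 4, (fderiv ℝ ψ (E4.ofTimeSpace t y) (E4.basisVector μ)) ^ 2)) +
      ENNReal.ofReal κs * Gf t := by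
    rw [hE ψ t]; exact (hsplit t ht0).1
  have h2 : Gf t ≤ 10 * (ENNReal.ofReal (Bc + 1) + 1) * (Gf ta + Kc) := by rw [← hBco]; exact hbound
  have h5 : (∫⁻ y in {y : E3 | ∀ i, Kerr.rPlus (M i) (a i) + η / 2 * M i ≤
      Kerr.radius (a i) (q i (E4.ofTimeSpace t y))},
        ENNReal.ofReal (∑ μ : Fin 4, (fderiv ℝ ψ (E4.ofTimeSpace t y) (E4.basisVector μ)) ^ 2)) ≤
      ENNReal.ofReal (Cfb : ℝ) * E ψ 0 := by
    rw [ENNReal.ofReal_coe_nnreal]; exact HFB' ψ hψ hsol t htt₁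
  have h6 : Kc = ENNReal.ofReal k * E ψ 0 := by
    rw [hKc, hW, ← mul_assoc, hk,
      ENNReal.ofReal_mul (by positivity : (0 : ℝ) ≤ 2 * Cs * U * (N * κs)),
      ENNReal.ofReal_coe_nnreal]
  refine (late_final_bound hκs0 (by positivity) hL0 (Cfb).2 hk0 h1 h2 (hGE ta hta0)
    (HFT ψ hψ hsol ta hta0) h5 h6).trans ?_
  show _ ≤ ENNReal.ofReal Cfin * E ψ 0
  exact mul_le_mul' (ENNReal.ofReal_le_ofReal (by rw [hCfin]; exact (lt_add_one _).le)) le_rfl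

end Summit.FinalStateConjecture.FinalStateConjecture.Cruxes.AdiabaticMultiKerrILED.Sketch

end
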